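import Summits.QuantumFields.QCD.Theorems.NestedDissectionSeaCoerciveSeaSchurSeparator
import Summits.QuantumFields.QCD.Theorems.NestedDissectionSeaSchurCellStep

/-!
# Crux `CoerciveSea` (stmt-QuantumFields-13901) — the separator event in the route's language:
# off the sixteen children's crossing masses, `HasSingularSeparator` IS `σ_min(S_Σ) < τ`

Companion of `NestedDissectionSeaCoerciveSeaSchurSeparator.lean` (kept line lead c1). The identification
`HasSingularSeparator U μ s τ ↔ ∃ v ≠ 0 on Σ, ‖S_Σ v‖² < τ²‖v‖²` was proved there under invertibility of the children
block `D_II`; by clause (a) of the proved route item `SchurCellStep` (`SchurCellStep.det_childrenBlock_eq_prod`: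
`det D_II = ∏_ε det D_{child ε}`, block diagonality) that hypothesis is exactly "none of the sixteen children Dirichlet
cells has a zero mode at `μ`" — the form in which the route's dilution clause (ii) / `SignDefectForcesCrossing` /
`EarlyCrosserLaw` speak (children crossings). [folklore]
-/

noncomputable section

open scoped BigOperators
open Matrix Literature.MathematicalPhysics.QuantumLattice Literature.MathematicalPhysics.QuantumFieldTheory
  Literature.Probability.LatticeModels

namespace Summit.QuantumFields.QCD.Theorems.NestedDissectionSeaCoerciveSea

/-- **The children block is invertible off the children's crossings**: if no child Dirichlet cell of the corner-`0`
box `s ≤ N` is singular at `μ`, then `det D_II ≠ 0` (product formula of `SchurCellStep` (a)). [folklore] -/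
theorem isUnit_det_childrenBlock_of_children {N : ℕ} [NeZero N]
    (U : GaugeConfig 4 N (Matrix.specialUnitaryGroup (Fin 3) ℂ)) (μ : ℝ) (s : Fin 4 → ℕ) (hsN : ∀ i, s i ≤ N)
    (hch : ∀ ε : Fin 4 → Bool, (wilsonCell U μ (halfCorner s ε) (halfSides s ε)).det ≠ 0) :
    IsUnit (childrenBlock U μ s).det := by
  rw [isUnit_iff_ne_zero, SchurCellStep.det_childrenBlock_eq_prod U μ s hsN]
  exact Finset.prod_ne_zero_iff.mpr fun ε _ => hch ε

/-- **`HasSingularSeparator` ↔ `σ_min(S_Σ) < τ`, children form** (registered stub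
`hasSingularSeparator_iff_schur_of_children` of crux stmt-QuantumFields-13901): for a corner-`0` box `s ≤ N` none of
whose sixteen children Dirichlet cells has a zero mode at the bare mass `μ`, the crux's separator event at level `τ`
holds iff the Schur separator matrix `schurSeparator U μ s` has a non-zero separator vector `v` with
`Σ_q ‖(S_Σ v)_q‖² < τ² Σ_q ‖v_q‖²`. [folklore] -/
theorem hasSingularSeparator_iff_schur_of_children :
    ∀ (N : ℕ) [NeZero N] (U : GaugeConfig 4 N (Matrix.specialUnitaryGroup (Fin 3) ℂ)) (μ : ℝ) (s : Fin 4 → ℕ)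
      (τ : ℝ), (∀ i, s i ≤ N) →
      (∀ ε : Fin 4 → Bool, (wilsonCell U μ (halfCorner s ε) (halfSides s ε)).det ≠ 0) →
      (HasSingularSeparator U μ s τ ↔
        ∃ v : {p : {p // wilsonBox (0 : TorusSite 4 N) s p} // ¬ childrenInterior s p} → ℂ, v ≠ 0 ∧
          ∑ q, ‖(schurSeparator U μ s).mulVec v q‖ ^ 2 < τ ^ 2 * ∑ q, ‖v q‖ ^ 2) :=
  fun N _ U μ s τ hsN hch =>
    hasSingularSeparator_iff_schur N U μ s τ (isUnit_det_childrenBlock_of_children U μ s hsN hch)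

end Summit.QuantumFields.QCD.Theorems.NestedDissectionSeaCoerciveSea

end
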